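import Summits.BirchSwinnertonDyer.Rank1Residual.X11b.BDPRouteTamagawaSupport
import Summits.BirchSwinnertonDyer.Rank1Residual.X11b.TamagawaLocalLemmas
import Summits.BirchSwinnertonDyer.Rank1Residual.X11b.TamagawaQuadraticPlaces
import Literature.NumberTheory.EllipticCurves.LangHeightNonarchEstimate
import Literature.NumberTheory.EllipticCurves.PAdicBSDSplitMultiplicativeProofs
import HarnessLib

/-!
# The Tamagawa-`3` support of an elliptic curve over `ℚ`, LOCALISED: `3 ∣ c_ℓ(E)` iff `E` is split
# multiplicative at `ℓ` with `3 ∣ ord_ℓ(Δ_min)`, OR additive at `ℓ` of Kodaira type `IV` / `IV*` with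
# `c_ℓ = 3` (team N8/O2 = cell `b2b-bsdres`, X11b at `p = 3`, sub-target T2P3-ANATOMY, seat x11b3-p3)

HONEST FRAMING (verbatim, cell `b2b-bsdres`, run/shared/lean/b2b/bsd-rank1-residual/): the goal of
the cell is to DELETE the COMBINATION-SHAPED residual classes for ALL analytic-rank `≤ 1` curves
over `ℚ` — "full BSD formula for every rank `≤ 1` curve in class `C`" assembled STRICTLY from
published theorems — so that the rank-`≤ 1` remainder becomes exactly the CONSTRUCTION-SHAPED
classes, which are TYPED (missing-input Props), NOT attempted; this is not "finishing BSD".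
Team N8/O2 works the class X11b at the prime `3` (`ClassX11b W 3`: `ord_{s=1} L(E,s) = 1`, `3 ∥ N`,
`E[3]` irreducible), whose class-level input STEP L at `3` has NO source, not even an announced one
(RESIDUAL-MAP §I O2, OPEN). Research route; nothing booked; NO label changes (X11 ∧ `r = 1` at
`p = 3` stays CONSTRUCTION-SHAPED, R6.2). THEOREMS ONLY: no definition, no named fact, no `sorry`;
the inputs are the tree's DISCHARGED Tate-algorithm / Kodaira–Néron facts (Silverman *ATAEC* IV.9.4,
Table 4.1), place by place.

## What this file does (the local and global halves; the class X11b@3 is treated in the companion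
## `X11b/Three/TamagawaAtomClass.lean`)

At primes `p > 3` the sibling sub-cell multr1-p2 LOCALISED the Tamagawa atom of route p2
(`BDPRouteTamagawaSupport.lean`, p212560): by Kodaira–Néron `c_ℓ ≤ 4` unless `ℓ` is split
multiplicative, so `p ∣ ∏c_ℓ` iff some split multiplicative `ℓ` has `p ∣ ord_ℓ(Δ_min)`. **At `p = 3`
the bound `c_ℓ ≤ 4` decides nothing**, and Tate's algorithm (tree facts
`localTamagawaNumber_of_kodairaSymbolAt_eq_IV_holds`, `…_IVstar_holds`, the `II/III/I₀*/Iₙ*/III*/II*`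
rows and the non-split `Iₙ` row `localTamagawaNumber_of_hasNonsplitMultiplicativeReductionAt_holds`)
says exactly which additive fibres carry a `3`: types `IV` and `IV*`, with `c ∈ {1, 3}`.

* §1 `split_or_typeIV_of_odd_prime_dvd_localTamagawaNumber` (any number field `K`, any finite place
  `w`): an ODD prime `p ∣ c_w` ⟹ split multiplicative with `p ∣ ord_w(Δ_min)`, OR `p = 3 ∧` type
  `IV`/`IV*` `∧ c_w = 3`; `not_good_not_mult_of_kodairaSymbolAt_IV`: such places are additive.
* §2 (`ℚ`, any elliptic `W`): `dvd_tamagawaProduct_iff_exists_place` (a prime divides `∏c_ℓ` iff it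
  divides some `c_v`); `odd_prime_dvd_tamagawaProduct_iff`; **`three_dvd_tamagawaProduct_iff`**:
  `3 ∣ ∏c_ℓ ⟺ (∃ split multiplicative ℓ, 3 ∣ ord_ℓ Δ_min) ∨ (∃ place of type IV/IV* with c = 3)`;
  `not_exists_typeIV_of_semistable` and `three_dvd_tamagawaProduct_iff_exists_split_of_semistable`
  — on SEMISTABLE curves the large-prime dichotomy holds verbatim at `3`.

Census (EVIDENCE, one engine — PARI `elllocalred`, kit job j119963, this seat; population =
multr1-p2's `census3` input, the 383 149 X11b@3 class-pairs `N < 5·10⁵`; NOT a fact, nothing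
booked): the equivalence `three_dvd_tamagawaProduct_iff` checked on 383 149 / 383 149 pairs
(0 violations; `3 ∣ ∏c_ℓ` on 128 897 = census3's count); a type-`IV`/`IV*` place with `c = 3`
occurs on 24 932 pairs, on 0 of the 151 556 semistable ones. Details and the class-level split:
companion file and `run/shared/lean/b2b/bsd-rank1-residual/b2b-bsdres-x11b3-p3/T2P3-ANATOMY.md`.

References: [SilvermanATAEC1994] IV.9.4 Steps 1–10 and Table 4.1 (PDF pp. 344–346), Cor. IV.9.2(d)
(p. 340); [SilvermanAEC2009] VII.5.1, VII.6.1.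
-/

noncomputable section

open scoped Classical

open WeierstrassCurve NumberField IsDedekindDomain Literature.NumberTheory.EllipticCurves
  Rat.HeightOneSpectrum
  Literature.NumberTheory.DiophantineGeometry
  Literature.NumberTheory.EllipticCurves.Rank1Residual

namespace Summit.BirchSwinnertonDyer.Rank1Residual.X11b.Three

/-! ### §0 Arithmetic helper: an odd prime dividing one of `1, 2, 3, 4` is `3` dividing `3` -/

/-- An odd prime dividing a number in `{1, 2, 3, 4}` is `3`, and the number is `3`. [folklore] -/
theorem eq_three_of_odd_prime_dvd {p c : ℕ} (hp : p.Prime) (hp2 : p ≠ 2)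
    (hc : c = 1 ∨ c = 2 ∨ c = 3 ∨ c = 4) (h : p ∣ c) : p = 3 ∧ c = 3 := by
  rcases hc with rfl | rfl | rfl | rfl
  · exact absurd (Nat.le_of_dvd one_pos h) (by have := hp.two_le; omega)
  · exact absurd ((Nat.prime_dvd_prime_iff_eq hp Nat.prime_two).mp h) hp2
  · exact ⟨(Nat.prime_dvd_prime_iff_eq hp Nat.prime_three).mp h, rfl⟩
  · exact absurd ((Nat.prime_dvd_prime_iff_eq hp Nat.prime_two).mp
      (hp.dvd_of_dvd_pow (show p ∣ 2 ^ 2 by simpa using h))) hp2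

/-! ### §1 Local: an odd prime dividing `c_w` — Tate's algorithm read at `p = 3` -/

section Local

variable {K : Type*} [Field K] [NumberField K] (X : WeierstrassCurve K) [X.IsElliptic]
  (w : HeightOneSpectrum (𝓞 K))

/-- **Kodaira–Néron refined at the prime `3` (any number field, any finite place `w`).** If an ODD
prime `p` divides the local Tamagawa number `c_w = [E(K_w) : E₀(K_w)]`, then EITHER the reduction
at `w` is split multiplicative and `p ∣ ord_w(Δ_min)` (type `Iₙ`, `c_w = n`), OR `p = 3`, the
Kodaira type at `w` is `IV` or `IV*` and `c_w = 3`. Proof: Tate's algorithm (Silverman *ATAEC*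
IV.9.4, Table 4.1) as discharged in the tree place by place — non-split `Iₙ`: `c ∈ {1,2}`;
`II, II*`: `1`; `III, III*`: `2`; `IV, IV*`: `1` or `3`; `I₀*`: `1, 2, 4`; `Iₙ*` (`n ≥ 1`): `2, 4`
(`NeronComponentIndex*Proofs`, `NonsplitProofs`, `TateAlgorithmProofs`). For primes `p > 3` the second
alternative is void and this is multr1-p2's `hasSplitMultiplicativeReduction_of_five_le_of_dvd_localTamagawaNumber`
("`c ≤ 4 < p`"); at `p = 3` the bound `c ≤ 4` decides nothing and the types `IV`, `IV*` survive.
[cite: SilvermanATAEC1994, IV.9.4 Steps 2–10 and Table 4.1 (PDF pp. 344–346)] -/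
theorem split_or_typeIV_of_odd_prime_dvd_localTamagawaNumber {p : ℕ} (hp : p.Prime) (hp2 : p ≠ 2)
    (hdvd : p ∣ (X.baseChange (w.adicCompletion K)).localTamagawaNumber (w.adicCompletionIntegers K)) :
    (X.HasSplitMultiplicativeReductionAt w ∧ p ∣ X.ordMinimalDiscriminant w) ∨
      (p = 3 ∧ (X.kodairaSymbolAt w = .IV ∨ X.kodairaSymbolAt w = .IVstar) ∧
        (X.baseChange (w.adicCompletion K)).localTamagawaNumber (w.adicCompletionIntegers K) = 3) := by
  haveI : Finite (IsLocalRing.ResidueField (w.adicCompletionIntegers K)) :=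
    HeightOneSpectrum.finite_residueField_adicCompletionIntegers K w
  haveI : PerfectField (IsLocalRing.ResidueField (w.adicCompletionIntegers K)) :=
    PerfectField.ofFinite
  haveI := X.isElliptic_localMinimalModel w
  by_cases hs : X.HasSplitMultiplicativeReductionAt w
  · left
    refine ⟨hs, ?_⟩
    rwa [localTamagawaNumber_eq_ordMinimalDiscriminant_of_hasSplitMultiplicativeReductionAt w X hs]
      at hdvd
  · right
    set c := (X.baseChange (w.adicCompletion K)).localTamagawaNumber (w.adicCompletionIntegers K)
      with hc
    rcases hk : X.kodairaSymbolAt w with (_ | m) | _ | _ | _ | (_ | n) | _ | _ | _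
    · -- `I₀`: good reduction, `c_w = 1`
      have hg : X.HasGoodReductionAt w :=
        (WeierstrassCurve.isGood_kodairaSymbolAt_iff_holds w X).mp hk
      have h1 : c = 1 := localTamagawaNumber_eq_one_of_good' w X
        (WeierstrassCurve.localTamagawaNumber_eq_one_of_hasGoodReduction_holds _ _) hg
      exact absurd (eq_three_of_odd_prime_dvd hp hp2 (Or.inl h1) hdvd).2 (by omega)
    · -- `Iₘ₊₁`: multiplicative, non-split, `c_w ∈ {1, 2}`
      obtain ⟨hmult, -⟩ :=
        (WeierstrassCurve.kodairaSymbolAt_eq_I_iff_holds w X m.succ_ne_zero).mp hk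
      have h12 : c = 1 ∨ c = 2 ∨ c = 3 ∨ c = 4 := by
        have := localTamagawaNumber_of_hasNonsplitMultiplicativeReductionAt_holds w X hmult hs
        rw [← hc] at this
        split_ifs at this
        · exact Or.inr (Or.inl this)
        · exact Or.inl this
      obtain ⟨-, h3⟩ := eq_three_of_odd_prime_dvd hp hp2 h12 hdvd
      have := localTamagawaNumber_of_hasNonsplitMultiplicativeReductionAt_holds w X hmult hs
      rw [← hc, h3] at this
      split_ifs at this <;> omega
    · -- `II`: `c = 1`
      have h1 : c = 1 := localTamagawaNumber_eq_one_of_kodairaSymbolAt_eq_II_holds w X hk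
      exact absurd (eq_three_of_odd_prime_dvd hp hp2 (Or.inl h1) hdvd).2 (by omega)
    · -- `III`: `c = 2`
      have h2 : c = 2 := localTamagawaNumber_eq_two_of_kodairaSymbolAt_eq_III_holds w X hk
      exact absurd (eq_three_of_odd_prime_dvd hp hp2 (Or.inr (Or.inl h2)) hdvd).2 (by omega)
    · -- `IV`: `c ∈ {1, 3}`
      have h13 : c = 1 ∨ c = 2 ∨ c = 3 ∨ c = 4 := by
        rcases localTamagawaNumber_of_kodairaSymbolAt_eq_IV_holds w X hk with h | h
        · exact Or.inl h
        · exact Or.inr (Or.inr (Or.inl h))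
      obtain ⟨hp3, h3⟩ := eq_three_of_odd_prime_dvd hp hp2 h13 hdvd
      exact ⟨hp3, Or.inl rfl, h3⟩
    · -- `I₀*`: `c ∈ {1, 2, 4}`
      have h124 : c = 1 ∨ c = 2 ∨ c = 3 ∨ c = 4 := by
        rcases localTamagawaNumber_of_kodairaSymbolAt_eq_Istar_zero_holds w X hk with h | h | h
        · exact Or.inl h
        · exact Or.inr (Or.inl h)
        · exact Or.inr (Or.inr (Or.inr h))
      obtain ⟨-, h3⟩ := eq_three_of_odd_prime_dvd hp hp2 h124 hdvd
      rcases localTamagawaNumber_of_kodairaSymbolAt_eq_Istar_zero_holds w X hk with h | h | h <;>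
        · rw [← hc] at h; omega
    · -- `Iₙ₊₁*`: `c ∈ {2, 4}`
      have h24 : c = 1 ∨ c = 2 ∨ c = 3 ∨ c = 4 := by
        rcases localTamagawaNumber_of_kodairaSymbolAt_eq_Istar_succ_holds w X n hk with h | h
        · exact Or.inr (Or.inl h)
        · exact Or.inr (Or.inr (Or.inr h))
      obtain ⟨-, h3⟩ := eq_three_of_odd_prime_dvd hp hp2 h24 hdvd
      rcases localTamagawaNumber_of_kodairaSymbolAt_eq_Istar_succ_holds w X n hk with h | h <;>
        · rw [← hc] at h; omega
    · -- `IV*`: `c ∈ {1, 3}`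
      have h13 : c = 1 ∨ c = 2 ∨ c = 3 ∨ c = 4 := by
        rcases localTamagawaNumber_of_kodairaSymbolAt_eq_IVstar_holds w X hk with h | h
        · exact Or.inl h
        · exact Or.inr (Or.inr (Or.inl h))
      obtain ⟨hp3, h3⟩ := eq_three_of_odd_prime_dvd hp hp2 h13 hdvd
      exact ⟨hp3, Or.inr rfl, h3⟩
    · -- `III*`: `c = 2`
      have h2 : c = 2 := localTamagawaNumber_eq_two_of_kodairaSymbolAt_eq_IIIstar_holds w X hk
      exact absurd (eq_three_of_odd_prime_dvd hp hp2 (Or.inr (Or.inl h2)) hdvd).2 (by omega)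
    · -- `II*`: `c = 1`
      have h1 : c = 1 := localTamagawaNumber_eq_one_of_kodairaSymbolAt_eq_IIstar_holds w X hk
      exact absurd (eq_three_of_odd_prime_dvd hp hp2 (Or.inl h1) hdvd).2 (by omega)

/-- **Types `IV` and `IV*` are ADDITIVE**: at such a place the reduction is neither good nor
multiplicative (Tate's algorithm Steps 1–2 return `I₀`, resp. `Iₙ` with `n = ord_w(Δ_min) ≥ 1`;
`isGood_kodairaSymbolAt_iff`, `kodairaSymbolAt_eq_I_iff`). [cite: SilvermanATAEC1994, IV.9.4 Steps 1–2 (PDF p. 344)] -/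
theorem not_good_not_mult_of_kodairaSymbolAt_IV
    (hk : X.kodairaSymbolAt w = .IV ∨ X.kodairaSymbolAt w = .IVstar) :
    ¬ X.HasGoodReductionAt w ∧ ¬ X.HasMultiplicativeReductionAt w := by
  haveI : Finite (IsLocalRing.ResidueField (w.adicCompletionIntegers K)) :=
    HeightOneSpectrum.finite_residueField_adicCompletionIntegers K w
  haveI : PerfectField (IsLocalRing.ResidueField (w.adicCompletionIntegers K)) :=
    PerfectField.ofFinite
  refine ⟨fun hg => ?_, fun hm => ?_⟩
  · have h0 : X.kodairaSymbolAt w = .I 0 :=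
      (WeierstrassCurve.isGood_kodairaSymbolAt_iff_holds w X).mpr hg
    rcases hk with hk | hk <;> rw [hk] at h0 <;> exact KodairaSymbol.noConfusion h0
  · have hn : X.ordMinimalDiscriminant w ≠ 0 :=
      (ordMinimalDiscriminant_pos_of_hasMultiplicativeReductionAt w X hm).ne'
    have hI : X.kodairaSymbolAt w = .I (X.ordMinimalDiscriminant w) :=
      (WeierstrassCurve.kodairaSymbolAt_eq_I_iff_holds w X hn).mpr ⟨hm, rfl⟩
    rcases hk with hk | hk <;> rw [hk] at hI <;> exact KodairaSymbol.noConfusion hI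

end Local

/-! ### §2 Global over `ℚ`: `3 ∣ ∏ c_ℓ` localised — the odd-prime dichotomy-plus-one -/

section Global

variable (W : WeierstrassCurve ℚ) [W.IsElliptic]

/-- A prime divides the Tamagawa product `∏_ℓ c_ℓ(E)` iff it divides one of its (finitely many
non-trivial) factors `c_v = W.tamagawaNumberAt v` (`∏ c_ℓ` IS the `finprod` of the `c_v` over the
places of `𝓞 ℚ`, `tamagawaProduct_eq_finprod_tamagawaNumberAt`; finiteness of the support =
`mulSupport_localTamagawaNumber_finite`). [folklore] -/
theorem dvd_tamagawaProduct_iff_exists_place {p : ℕ} (hp : p.Prime) :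
    p ∣ W.tamagawaProduct ↔ ∃ v : HeightOneSpectrum (𝓞 ℚ), p ∣ W.tamagawaNumberAt v := by
  have hfin : (Function.mulSupport fun v : HeightOneSpectrum (𝓞 ℚ) => W.tamagawaNumberAt v).Finite :=
    W.mulSupport_localTamagawaNumber_finite_holds
  constructor
  · intro h
    rw [W.tamagawaProduct_eq_finprod_tamagawaNumberAt, finprod_eq_prod _ hfin] at h
    obtain ⟨v, -, hv⟩ := hp.prime.exists_mem_finset_dvd h
    exact ⟨v, hv⟩
  · rintro ⟨v, hv⟩
    have hsub : (Function.mulSupport fun v : HeightOneSpectrum (𝓞 ℚ) => W.tamagawaNumberAt v) ⊆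
        ↑(insert v hfin.toFinset) := fun u hu => by
      rw [Finset.coe_insert]
      exact Set.mem_insert_of_mem _ (hfin.mem_toFinset.mpr hu)
    rw [W.tamagawaProduct_eq_finprod_tamagawaNumberAt, finprod_eq_prod_of_mulSupport_subset _ hsub]
    exact dvd_trans hv (Finset.dvd_prod_of_mem _ (Finset.mem_insert_self v _))

variable [W.IsGloballyMinimal]

/-- **An ODD prime `p` divides `∏_ℓ c_ℓ(E)` iff EITHER some split multiplicative prime `ℓ` has
`p ∣ ord_ℓ(Δ_min(E))` OR `p = 3` and some place has Kodaira type `IV` or `IV*` with `c = 3`.**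
For primes `p > 3` the second alternative is void and this is the sibling's
`dvd_tamagawaProduct_iff_exists_split` (multr1-p2, `BDPRouteTamagawaSupport.lean`); at `p = 3` the
additive types `IV`, `IV*` (`c ∈ {1, 3}`, Tate's algorithm Steps 5 and 8) are a genuine second
source of the prime `3` in the Tamagawa product. (⇐, split case) is the sibling's prime-free
`dvd_tamagawaProduct_of_split_of_dvd`. [cite: SilvermanATAEC1994, IV.9.4 Steps 2, 5, 8 and Table 4.1 (PDF pp. 344–346)] -/
theorem odd_prime_dvd_tamagawaProduct_iff {p : ℕ} (hp : p.Prime) (hp2 : p ≠ 2) :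
    p ∣ W.tamagawaProduct ↔
      (∃ ℓ : ℕ, ∃ _ : Fact ℓ.Prime, W.HasSplitMultiplicativeReductionAtPrime ℓ ∧
          p ∣ padicValInt ℓ W.minimalDiscriminantInt) ∨
        (p = 3 ∧ ∃ v : HeightOneSpectrum (𝓞 ℚ),
          (W.kodairaSymbolAt v = .IV ∨ W.kodairaSymbolAt v = .IVstar) ∧ W.tamagawaNumberAt v = 3) := by
  constructor
  · intro h
    obtain ⟨v, hv⟩ := (dvd_tamagawaProduct_iff_exists_place W hp).mp h
    rcases split_or_typeIV_of_odd_prime_dvd_localTamagawaNumber W v hp hp2 hv with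
      ⟨hs, hd⟩ | ⟨hp3, hk, hc⟩
    · left
      haveI := Fact.mk (primesEquiv v).2
      refine ⟨(primesEquiv v : ℕ), inferInstance,
        (W.hasSplitMultiplicativeReductionAtPrime_iff_hasSplitMultiplicativeReductionAt v).mpr hs, ?_⟩
      rwa [← ordMinimalDiscriminant_eq_padicValInt W v rfl]
    · exact Or.inr ⟨hp3, v, hk, hc⟩
  · rintro (⟨ℓ, _, hs, hd⟩ | ⟨rfl, v, -, hc⟩)
    · exact dvd_tamagawaProduct_of_split_of_dvd W hs hd
    · exact (dvd_tamagawaProduct_iff_exists_place W hp).mpr ⟨v, by rw [hc]⟩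

/-- **`p = 3`: the Tamagawa-`3` support of ANY elliptic curve over `ℚ`, localised.** `3 ∣ ∏_ℓ c_ℓ(E)`
iff some SPLIT multiplicative `ℓ` has `3 ∣ ord_ℓ(Δ_min)` or some ADDITIVE place has Kodaira type
`IV`/`IV*` with `c = 3`. [cite: SilvermanATAEC1994, IV.9.4 Steps 2, 5, 8 and Table 4.1 (PDF pp. 344–346)] -/
theorem three_dvd_tamagawaProduct_iff :
    3 ∣ W.tamagawaProduct ↔
      (∃ ℓ : ℕ, ∃ _ : Fact ℓ.Prime, W.HasSplitMultiplicativeReductionAtPrime ℓ ∧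
          3 ∣ padicValInt ℓ W.minimalDiscriminantInt) ∨
        ∃ v : HeightOneSpectrum (𝓞 ℚ),
          (W.kodairaSymbolAt v = .IV ∨ W.kodairaSymbolAt v = .IVstar) ∧ W.tamagawaNumberAt v = 3 := by
  rw [odd_prime_dvd_tamagawaProduct_iff W Nat.prime_three (by decide)]
  simp only [true_and]

omit [W.IsGloballyMinimal] in
/-- **On a SEMISTABLE curve there is no `IV`/`IV*` place** (those types are additive:
`not_good_not_mult_of_kodairaSymbolAt_IV`; the cell's `Semistable W` = good or multiplicative at
every prime, transported to the places of `𝓞 ℚ` by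
`hasGoodReductionAtPrime_iff_hasGoodReductionAt_ringOfIntegers` /
`hasMultiplicativeReductionAtPrime_iff_hasMultiplicativeReductionAt_ringOfIntegers`). [folklore] -/
theorem not_exists_typeIV_of_semistable (hsst : Semistable W) :
    ¬ ∃ v : HeightOneSpectrum (𝓞 ℚ),
      (W.kodairaSymbolAt v = .IV ∨ W.kodairaSymbolAt v = .IVstar) ∧ W.tamagawaNumberAt v = 3 := by
  rintro ⟨v, hk, -⟩
  obtain ⟨hng, hnm⟩ := not_good_not_mult_of_kodairaSymbolAt_IV W v hk
  haveI := Fact.mk (primesEquiv v).2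
  rcases hsst (primesEquiv v) (primesEquiv v).2 with hg | hm
  · exact hng ((hasGoodReductionAtPrime_iff_hasGoodReductionAt_ringOfIntegers v W).mp hg)
  · exact hnm
      ((W.hasMultiplicativeReductionAtPrime_iff_hasMultiplicativeReductionAt_ringOfIntegers v).mp hm)

/-- **On SEMISTABLE curves the large-prime dichotomy holds verbatim at `p = 3`**: `3 ∣ ∏ c_ℓ` iff some
split multiplicative `ℓ` has `3 ∣ ord_ℓ(Δ_min)`. [cite: SilvermanATAEC1994, Cor. IV.9.2(d) (PDF p. 340)] -/
theorem three_dvd_tamagawaProduct_iff_exists_split_of_semistable (hsst : Semistable W) :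
    3 ∣ W.tamagawaProduct ↔
      ∃ ℓ : ℕ, ∃ _ : Fact ℓ.Prime, W.HasSplitMultiplicativeReductionAtPrime ℓ ∧
        3 ∣ padicValInt ℓ W.minimalDiscriminantInt := by
  rw [three_dvd_tamagawaProduct_iff W]
  exact ⟨fun h => h.resolve_right (not_exists_typeIV_of_semistable W hsst), Or.inl⟩

end Global

end Summit.BirchSwinnertonDyer.Rank1Residual.X11b.Three

end
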